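import Summits.HodgeConjecture.CorCM.IrreducibleOddWeightsShadowModulesOneSided
import Summits.HodgeConjecture.CorCM.IrreducibleOddWeightsShadowModulesDefect
import HarnessLib

/-!
# Shadow modules, XI: ONE-DIMENSIONAL CONSTITUENTS (quadratic characters) are INVISIBLE to the defect unless SHARED —
# shadows `w = a + a′` with `a` in an irreducible module of dimension `≠ 1` and `a′` on a stable LINE: the meet
# `S(w₀) ∩ S(w₁)` is `S(a₀) ∩ S(a₁)` when the two lines differ

COR-CM (cell `pub-hodgecm2`, binder seat `b16` gen 69, count-neutral claim ROW SPACES OVER THE COMMUTANT, file Q11 —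
abstract `G`-set level, in the lane's own language; theorems only, no definition, no named fact, no `sorry`).  NEW as
stated, hence under `Summits/`.  HONEST FRAMING: linear algebra of translates of functions on finite `G`-sets (files Q3,
Q3b, Q7: the meet theorem, the dichotomy, and «`S(a)` has no proper non-zero right-stable subspace»), for shadow modules
that are the sum of an irreducible module of dimension `≥ 2` and a stable LINE — the first REDUCIBLE case (this
generation's census base #24, `Anti = χ ⊕ V` over `C₂ × S₃`, defect values `{2} = {dim V}`); consequences for the
Kubota–Dodson rank only; `HC_CM` is neither used nor asserted.

DICTIONARY.  A stable line in `Anti(T)` is a rational odd CHARACTER of the Galois action, i.e. the sign character of an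
imaginary quadratic subfield of (the Galois closure seen by) `T`; «the two lines differ» = the two slots do not see the same
quadratic character.  A shared line contributes (at most) one dimension — compare gen 65 C9 («an imaginary quadratic mutual
trace allows at most ONE dimension of interaction»).

* §1 Lines: a stable 1-dimensional `A′` is irreducible (`irreducible_of_finrank_eq_one`), `dim S(a′) = 1`, right
  translations act on a right-stable line by scalars (`exists_translate_eq_smul_of_finrank_eq_one`); a right-stable line
  meets no `S(a)` with `A` irreducible of dimension `≠ 1` (`span_shadowCoeff_inf_eq_bot_of_finrank_eq_one`, Q7) and no sum
  `S(a) + S(b)` of two such (`inf_sup_eq_bot_of_finrank_eq_one`).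
* §2 **`S(a + a′) = S(a) ⊔ S(a′)`** with `S(a) ⊓ S(a′) = 0` (`span_shadowCoeff_add_eq_sup`): the translates of `a + a′`
  recover both components (dimension count with Q7's right-irreducibility).
* §3 (file Q11b `IrreducibleOddWeightsShadowModulesCharactersDefect`): **`S(a₀ + a₀′) ∩ S(a₁ + a₁′) = S(a₀) ∩ S(a₁)`
  when the lines `S(a₀′)`, `S(a₁′)` are DISJOINT** — the characters differ at some group element, which separates the
  line components from `S(a₀) + S(a₁)`; hence the defect is `dim(S(a₀) ∩ S(a₁)) ∈ {0, dim A₀}` (Q3).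

## References

* [Gordon1999HodgeAVSurvey] B. B. Gordon, *A survey of the Hodge conjecture for abelian varieties*, §3 Theorem (proof),
  7.5–7.7, 9.4.3.
* [Serre1977] J.-P. Serre, *Linear Representations of Finite Groups*, GTM 42, §2.2, §2.6 (canonical decomposition).
-/

set_option autoImplicit false

noncomputable section

open scoped BigOperators Classical

universe u v v' v'' w

namespace Summit.HodgeConjecture.CorCM.IrrOdd

open Literature.NumberTheory.ComplexMultiplication

variable {G : Type w} [Group G] {Y₀ : Type v'} [MulAction G Y₀] [Fintype Y₀] [DecidableEq Y₀]
  {Y₁ : Type v''} [MulAction G Y₁] [Fintype Y₁] [DecidableEq Y₁]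

/-! ### §1 Lines -/

omit [MulAction G Y₀] [Fintype Y₀] [DecidableEq Y₀] in
/-- A stable ONE-DIMENSIONAL subspace is irreducible (lane shape). [cite: Serre1977, §2.2] -/
theorem irreducible_of_finrank_eq_one [MulAction G Y₀] {A' : Submodule ℚ (Y₀ → ℚ)} (h1 : Module.finrank ℚ A' = 1) :
    ∀ W : Submodule ℚ (Y₀ → ℚ), W ≤ A' → W ≠ ⊥ →
      (∀ (k : G) (f : Y₀ → ℚ), f ∈ W → (fun y => f (k • y)) ∈ W) → W = A' := by
  intro W hW hW0 _
  haveI : FiniteDimensional ℚ A' := Module.finite_of_finrank_eq_succ h1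
  haveI : FiniteDimensional ℚ W := Submodule.finiteDimensional_of_le hW
  refine Submodule.eq_of_le_of_finrank_le hW ?_
  rw [h1]
  exact Nat.one_le_iff_ne_zero.2 fun h0 => hW0 (Submodule.finrank_eq_zero.1 h0)

omit [DecidableEq Y₀] in
/-- `dim S(a′) = 1` for `0 ≠ a′` in a stable line. [cite: Serre1977, §2.2] -/
theorem finrank_span_shadowCoeff_eq_one {A' : Submodule ℚ (Y₀ → ℚ)}
    (hAst' : ∀ (k : G) (a : Y₀ → ℚ), a ∈ A' → (fun y => a (k • y)) ∈ A') (h1 : Module.finrank ℚ A' = 1)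
    {a' : Y₀ → ℚ} (ha' : a' ∈ A') (ha'0 : a' ≠ 0) :
    Module.finrank ℚ (Submodule.span ℚ (Set.range fun y : Y₀ => fun g : G => a' (g • y))) = 1 := by
  rw [finrank_span_shadowCoeff_eq_of_irreducible hAst' (irreducible_of_finrank_eq_one (G := G) h1) ha' ha'0, h1]

/-- On a right-stable LINE of `ℚ^G` every right translation acts by a scalar. [cite: Serre1977, §2.2] -/
theorem exists_translate_eq_smul_of_finrank_eq_one {N : Submodule ℚ (G → ℚ)} [FiniteDimensional ℚ N]
    (hN1 : Module.finrank ℚ N = 1) (hNst : ∀ (k : G) (c : G → ℚ), c ∈ N → (fun g => c (g * k)) ∈ N)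
    {c : G → ℚ} (hc : c ∈ N) (k : G) : ∃ ε : ℚ, (fun g => c (g * k)) = ε • c := by
  by_cases hc0 : c = 0
  · exact ⟨0, by subst hc0; funext g; simp⟩
  have hspan : Submodule.span ℚ {c} = N := by
    refine Submodule.eq_of_le_of_finrank_le ((Submodule.span_singleton_le_iff_mem c N).2 hc) ?_
    rw [hN1, finrank_span_singleton hc0]
  have hmem : (fun g => c (g * k)) ∈ Submodule.span ℚ {c} := by
    rw [hspan]
    exact hNst k c hc
  obtain ⟨ε, hε⟩ := Submodule.mem_span_singleton.1 hmem
  exact ⟨ε, hε.symm⟩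

omit [DecidableEq Y₀] in
/-- A right-stable LINE meets no `S(a)` with `A` stable irreducible of dimension `≠ 1` (Q7: `S(a)` has no proper non-zero
right-stable subspace, and `dim S(a) = dim A`). [cite: Serre1977, §2.2 and §2.6] -/
theorem span_shadowCoeff_inf_eq_bot_of_finrank_eq_one {A : Submodule ℚ (Y₀ → ℚ)}
    (hAst : ∀ (k : G) (a : Y₀ → ℚ), a ∈ A → (fun y => a (k • y)) ∈ A)
    (hirr : ∀ W : Submodule ℚ (Y₀ → ℚ), W ≤ A → W ≠ ⊥ →
      (∀ (k : G) (f : Y₀ → ℚ), f ∈ W → (fun y => f (k • y)) ∈ W) → W = A)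
    (hA1 : Module.finrank ℚ A ≠ 1) {a : Y₀ → ℚ} (ha : a ∈ A) {N : Submodule ℚ (G → ℚ)} [FiniteDimensional ℚ N]
    (hN1 : Module.finrank ℚ N = 1) (hNst : ∀ (k : G) (c : G → ℚ), c ∈ N → (fun g => c (g * k)) ∈ N) :
    Submodule.span ℚ (Set.range fun y : Y₀ => fun g : G => a (g • y)) ⊓ N = ⊥ := by
  by_cases ha0 : a = 0
  · rw [(span_shadowCoeff_eq_bot_iff (G := G) a).2 ha0, bot_inf_eq]
  rcases eq_bot_or_eq_of_rightStable hAst hirr ha (N := Submodule.span ℚ (Set.range fun y : Y₀ => fun g : G =>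
      a (g • y)) ⊓ N) inf_le_left (fun k c hc => ⟨translate_shadowCoeff_mem a k hc.1, hNst k c hc.2⟩) with h | h
  · exact h
  · exfalso
    have hle : Submodule.span ℚ (Set.range fun y : Y₀ => fun g : G => a (g • y)) ≤ N := by
      rw [← h]; exact inf_le_right
    have hdim := Submodule.finrank_mono hle
    rw [finrank_span_shadowCoeff_eq_of_irreducible hAst hirr ha ha0, hN1] at hdim
    -- `dim A ≤ 1` and `A ∋ a ≠ 0` force `dim A = 1`
    have hpos : 0 < Module.finrank ℚ A := by
      rw [Module.finrank_pos_iff_exists_ne_zero]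
      exact ⟨⟨a, ha⟩, fun h0 => ha0 (congrArg Subtype.val h0)⟩
    omega

omit [DecidableEq Y₀] in
/-- A vector of `S(a)` on which every right translation acts by a scalar is zero, when `A` is stable irreducible of
dimension `≠ 1` (its line would be a right-stable line in `S(a)`). [cite: Serre1977, §2.2 and §2.6] -/
theorem eq_zero_of_forall_translate_eq_smul {A : Submodule ℚ (Y₀ → ℚ)}
    (hAst : ∀ (k : G) (a : Y₀ → ℚ), a ∈ A → (fun y => a (k • y)) ∈ A)
    (hirr : ∀ W : Submodule ℚ (Y₀ → ℚ), W ≤ A → W ≠ ⊥ →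
      (∀ (k : G) (f : Y₀ → ℚ), f ∈ W → (fun y => f (k • y)) ∈ W) → W = A)
    (hA1 : Module.finrank ℚ A ≠ 1) {a : Y₀ → ℚ} (ha : a ∈ A) {x : G → ℚ}
    (hx : x ∈ Submodule.span ℚ (Set.range fun y : Y₀ => fun g : G => a (g • y)))
    (hxst : ∀ k : G, ∃ ε : ℚ, (fun g => x (g * k)) = ε • x) : x = 0 := by
  by_contra hx0
  haveI : FiniteDimensional ℚ (Submodule.span ℚ ({x} : Set (G → ℚ))) :=
    FiniteDimensional.span_of_finite ℚ (Set.finite_singleton x)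
  have h := span_shadowCoeff_inf_eq_bot_of_finrank_eq_one hAst hirr hA1 ha (N := Submodule.span ℚ {x})
    (finrank_span_singleton hx0) (fun k c hc => by
      obtain ⟨t, rfl⟩ := Submodule.mem_span_singleton.1 hc
      obtain ⟨ε, hε⟩ := hxst k
      have e : (fun g => (t • x) (g * k)) = (t * ε) • x := by
        funext g
        have hg := congrFun hε g
        simp only [Pi.smul_apply, smul_eq_mul] at hg ⊢
        rw [hg]; ring
      rw [e]
      exact Submodule.smul_mem _ _ (Submodule.mem_span_singleton_self x))
  have hmem : x ∈ Submodule.span ℚ (Set.range fun y : Y₀ => fun g : G => a (g • y)) ⊓ Submodule.span ℚ {x} :=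
    ⟨hx, Submodule.mem_span_singleton_self x⟩
  rw [h] at hmem
  exact hx0 ((Submodule.mem_bot ℚ).1 hmem)

omit [DecidableEq Y₀] [DecidableEq Y₁] in
/-- **A right-stable LINE meets no `S(a) + S(b)`** for `A, B` stable irreducible of dimensions `≠ 1` (on two possibly
different `G`-sets). [cite: Serre1977, §2.2 and §2.6] -/
theorem inf_sup_eq_bot_of_finrank_eq_one {A : Submodule ℚ (Y₀ → ℚ)} {B : Submodule ℚ (Y₁ → ℚ)}
    (hAst : ∀ (k : G) (a : Y₀ → ℚ), a ∈ A → (fun y => a (k • y)) ∈ A)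
    (hirrA : ∀ W : Submodule ℚ (Y₀ → ℚ), W ≤ A → W ≠ ⊥ →
      (∀ (k : G) (f : Y₀ → ℚ), f ∈ W → (fun y => f (k • y)) ∈ W) → W = A)
    (hA1 : Module.finrank ℚ A ≠ 1)
    (hBst : ∀ (k : G) (b : Y₁ → ℚ), b ∈ B → (fun y => b (k • y)) ∈ B)
    (hirrB : ∀ W : Submodule ℚ (Y₁ → ℚ), W ≤ B → W ≠ ⊥ →
      (∀ (k : G) (f : Y₁ → ℚ), f ∈ W → (fun y => f (k • y)) ∈ W) → W = B)
    (hB1 : Module.finrank ℚ B ≠ 1) {a : Y₀ → ℚ} (ha : a ∈ A) {b : Y₁ → ℚ} (hb : b ∈ B)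
    {N : Submodule ℚ (G → ℚ)} [FiniteDimensional ℚ N] (hN1 : Module.finrank ℚ N = 1)
    (hNst : ∀ (k : G) (c : G → ℚ), c ∈ N → (fun g => c (g * k)) ∈ N) :
    N ⊓ (Submodule.span ℚ (Set.range fun y : Y₀ => fun g : G => a (g • y)) ⊔
      Submodule.span ℚ (Set.range fun y : Y₁ => fun g : G => b (g • y))) = ⊥ := by
  rcases span_shadowCoeff_inf_eq_bot_or_eq hAst hirrA hBst hirrB ha hb with hdisj | heq
  · rw [Submodule.eq_bot_iff]
    rintro c ⟨hcN, hcU⟩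
    obtain ⟨x, hx, z, hz, rfl⟩ := Submodule.mem_sup.1 hcU
    -- right translations act on `x + z` by scalars; by uniqueness of the decomposition, on `x` and on `z` too
    have hsplit : ∀ k : G, ∃ ε : ℚ, (fun g => x (g * k)) = ε • x ∧ (fun g => z (g * k)) = ε • z := by
      intro k
      obtain ⟨ε, hε⟩ := exists_translate_eq_smul_of_finrank_eq_one hN1 hNst hcN k
      refine ⟨ε, ?_⟩
      have hmem : (fun g => x (g * k)) - ε • x ∈ Submodule.span ℚ (Set.range fun y : Y₀ => fun g : G => a (g • y)) ⊓
          Submodule.span ℚ (Set.range fun y : Y₁ => fun g : G => b (g • y)) := by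
        refine ⟨Submodule.sub_mem _ (translate_shadowCoeff_mem a k hx) (Submodule.smul_mem _ _ hx), ?_⟩
        have e : (fun g => x (g * k)) - ε • x = -((fun g => z (g * k)) - ε • z) := by
          funext g
          have hg := congrFun hε g
          simp only [Pi.add_apply, Pi.smul_apply, smul_eq_mul, Pi.sub_apply, Pi.neg_apply] at hg ⊢
          linarith
        rw [e]
        exact Submodule.neg_mem _ (Submodule.sub_mem _ (translate_shadowCoeff_mem b k hz) (Submodule.smul_mem _ _ hz))
      rw [hdisj, Submodule.mem_bot, sub_eq_zero] at hmem
      refine ⟨hmem, ?_⟩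
      funext g
      have hg := congrFun hε g
      have hxg := congrFun hmem g
      simp only [Pi.add_apply, Pi.smul_apply, smul_eq_mul] at hg hxg ⊢
      linarith
    have hx0 : x = 0 := eq_zero_of_forall_translate_eq_smul hAst hirrA hA1 ha hx fun k =>
      (hsplit k).imp fun ε h => h.1
    have hz0 : z = 0 := eq_zero_of_forall_translate_eq_smul hBst hirrB hB1 hb hz fun k =>
      (hsplit k).imp fun ε h => h.2
    rw [hx0, hz0, add_zero]
  · rw [heq, sup_idem, inf_comm]
    exact span_shadowCoeff_inf_eq_bot_of_finrank_eq_one hBst hirrB hB1 hb hN1 hNst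

/-! ### §2 `S(a + a′) = S(a) ⊔ S(a′)` -/

omit [Fintype Y₀] [DecidableEq Y₀] in
/-- `S(a + a′) ≤ S(a) ⊔ S(a′)` (generatorwise). [folklore] -/
theorem span_shadowCoeff_add_le (a a' : Y₀ → ℚ) :
    Submodule.span ℚ (Set.range fun y : Y₀ => fun g : G => (a + a') (g • y)) ≤
      Submodule.span ℚ (Set.range fun y : Y₀ => fun g : G => a (g • y)) ⊔
        Submodule.span ℚ (Set.range fun y : Y₀ => fun g : G => a' (g • y)) := by
  rw [Submodule.span_le]
  rintro _ ⟨y, rfl⟩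
  have e : (fun g : G => (a + a') (g • y)) = (fun g : G => a (g • y)) + fun g : G => a' (g • y) := rfl
  show (fun g : G => (a + a') (g • y)) ∈ _
  rw [e]
  exact Submodule.add_mem_sup (Submodule.subset_span ⟨y, rfl⟩) (Submodule.subset_span ⟨y, rfl⟩)

omit [Fintype Y₀] [DecidableEq Y₀] in
/-- `S(a) ≤ S(a + a′) ⊔ S(a′)` (write `c_y^a = c_y^{a+a′} − c_y^{a′}`). [folklore] -/
theorem span_shadowCoeff_le_add_sup (a a' : Y₀ → ℚ) :
    Submodule.span ℚ (Set.range fun y : Y₀ => fun g : G => a (g • y)) ≤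
      Submodule.span ℚ (Set.range fun y : Y₀ => fun g : G => (a + a') (g • y)) ⊔
        Submodule.span ℚ (Set.range fun y : Y₀ => fun g : G => a' (g • y)) := by
  rw [Submodule.span_le]
  rintro _ ⟨y, rfl⟩
  have e : (fun g : G => a (g • y)) = (fun g : G => (a + a') (g • y)) - fun g : G => a' (g • y) := by
    funext g; simp
  show (fun g : G => a (g • y)) ∈ _
  rw [e]
  exact Submodule.sub_mem _ (Submodule.mem_sup_left (Submodule.subset_span ⟨y, rfl⟩))
    (Submodule.mem_sup_right (Submodule.subset_span ⟨y, rfl⟩))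

omit [DecidableEq Y₀] in
/-- **`S(a + a′) = S(a) ⊔ S(a′)`** when `a` lies in a stable irreducible module of dimension `≠ 1` and `a′` in a stable
line: the translates of the sum recover both components. [cite: Serre1977, §2.6] -/
theorem span_shadowCoeff_add_eq_sup {A A' : Submodule ℚ (Y₀ → ℚ)}
    (hAst : ∀ (k : G) (a : Y₀ → ℚ), a ∈ A → (fun y => a (k • y)) ∈ A)
    (hirr : ∀ W : Submodule ℚ (Y₀ → ℚ), W ≤ A → W ≠ ⊥ →
      (∀ (k : G) (f : Y₀ → ℚ), f ∈ W → (fun y => f (k • y)) ∈ W) → W = A)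
    (hA1 : Module.finrank ℚ A ≠ 1)
    (hAst' : ∀ (k : G) (a : Y₀ → ℚ), a ∈ A' → (fun y => a (k • y)) ∈ A') (h1 : Module.finrank ℚ A' = 1)
    {a a' : Y₀ → ℚ} (ha : a ∈ A) (ha' : a' ∈ A') :
    Submodule.span ℚ (Set.range fun y : Y₀ => fun g : G => (a + a') (g • y)) =
      Submodule.span ℚ (Set.range fun y : Y₀ => fun g : G => a (g • y)) ⊔
        Submodule.span ℚ (Set.range fun y : Y₀ => fun g : G => a' (g • y)) := by
  by_cases ha'0 : a' = 0
  · rw [ha'0, add_zero, (span_shadowCoeff_eq_bot_iff (G := G) (0 : Y₀ → ℚ)).2 rfl, sup_bot_eq]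
  by_cases ha0 : a = 0
  · rw [ha0, zero_add, (span_shadowCoeff_eq_bot_iff (G := G) (0 : Y₀ → ℚ)).2 rfl, bot_sup_eq]
  haveI hf₀ : FiniteDimensional ℚ (Submodule.span ℚ (Set.range fun y : Y₀ => fun g : G => a (g • y))) :=
    FiniteDimensional.span_of_finite ℚ (Set.finite_range _)
  haveI hf₁ : FiniteDimensional ℚ (Submodule.span ℚ (Set.range fun y : Y₀ => fun g : G => a' (g • y))) :=
    FiniteDimensional.span_of_finite ℚ (Set.finite_range _)
  haveI hf₂ : FiniteDimensional ℚ (Submodule.span ℚ (Set.range fun y : Y₀ => fun g : G => (a + a') (g • y))) :=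
    FiniteDimensional.span_of_finite ℚ (Set.finite_range _)
  have hline : Module.finrank ℚ (Submodule.span ℚ (Set.range fun y : Y₀ => fun g : G => a' (g • y))) = 1 :=
    finrank_span_shadowCoeff_eq_one hAst' h1 ha' ha'0
  have hdisj : Submodule.span ℚ (Set.range fun y : Y₀ => fun g : G => a (g • y)) ⊓
      Submodule.span ℚ (Set.range fun y : Y₀ => fun g : G => a' (g • y)) = ⊥ :=
    span_shadowCoeff_inf_eq_bot_of_finrank_eq_one hAst hirr hA1 ha hline (fun k c hc => translate_shadowCoeff_mem a' k hc)
  refine le_antisymm (span_shadowCoeff_add_le a a') ?_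
  have hNle := span_shadowCoeff_add_le (G := G) a a'
  -- Q7 on `S(a + a′) ⊓ S(a)`
  rcases eq_bot_or_eq_of_rightStable hAst hirr ha
    (N := Submodule.span ℚ (Set.range fun y : Y₀ => fun g : G => (a + a') (g • y)) ⊓
      Submodule.span ℚ (Set.range fun y : Y₀ => fun g : G => a (g • y))) inf_le_right
    (fun k c hc => ⟨translate_shadowCoeff_mem (a + a') k hc.1, translate_shadowCoeff_mem a k hc.2⟩) with h0 | hS
  · exfalso
    -- also `S(a + a′) ⊓ S(a′) = ⊥`
    have h0' : Submodule.span ℚ (Set.range fun y : Y₀ => fun g : G => (a + a') (g • y)) ⊓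
        Submodule.span ℚ (Set.range fun y : Y₀ => fun g : G => a' (g • y)) = ⊥ := by
      rcases eq_bot_or_eq_of_rightStable hAst' (irreducible_of_finrank_eq_one (G := G) h1) ha'
        (N := Submodule.span ℚ (Set.range fun y : Y₀ => fun g : G => (a + a') (g • y)) ⊓
          Submodule.span ℚ (Set.range fun y : Y₀ => fun g : G => a' (g • y))) inf_le_right
        (fun k c hc => ⟨translate_shadowCoeff_mem (a + a') k hc.1, translate_shadowCoeff_mem a' k hc.2⟩) with h | h
      · exact h
      · exfalso
        have hle' : Submodule.span ℚ (Set.range fun y : Y₀ => fun g : G => a' (g • y)) ≤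
            Submodule.span ℚ (Set.range fun y : Y₀ => fun g : G => (a + a') (g • y)) := by
          rw [← h]; exact inf_le_left
        have hle : Submodule.span ℚ (Set.range fun y : Y₀ => fun g : G => a (g • y)) ≤
            Submodule.span ℚ (Set.range fun y : Y₀ => fun g : G => (a + a') (g • y)) :=
          (span_shadowCoeff_le_add_sup a a').trans (sup_le le_rfl hle')
        rw [inf_eq_right.2 hle] at h0
        exact ha0 ((span_shadowCoeff_eq_bot_iff (G := G) a).1 h0)
    -- dimension count
    have hsup : Submodule.span ℚ (Set.range fun y : Y₀ => fun g : G => (a + a') (g • y)) ⊔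
        Submodule.span ℚ (Set.range fun y : Y₀ => fun g : G => a (g • y)) =
        Submodule.span ℚ (Set.range fun y : Y₀ => fun g : G => a (g • y)) ⊔
          Submodule.span ℚ (Set.range fun y : Y₀ => fun g : G => a' (g • y)) := by
      refine le_antisymm (sup_le hNle le_sup_left) (sup_le le_sup_right ?_)
      have h := span_shadowCoeff_le_add_sup (G := G) a' a
      rwa [add_comm a' a] at h
    have hsup' : Submodule.span ℚ (Set.range fun y : Y₀ => fun g : G => (a + a') (g • y)) ⊔
        Submodule.span ℚ (Set.range fun y : Y₀ => fun g : G => a' (g • y)) =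
        Submodule.span ℚ (Set.range fun y : Y₀ => fun g : G => a (g • y)) ⊔
          Submodule.span ℚ (Set.range fun y : Y₀ => fun g : G => a' (g • y)) :=
      le_antisymm (sup_le hNle le_sup_right) (sup_le (span_shadowCoeff_le_add_sup a a') le_sup_right)
    have e1 := Submodule.finrank_sup_add_finrank_inf_eq
      (Submodule.span ℚ (Set.range fun y : Y₀ => fun g : G => (a + a') (g • y)))
      (Submodule.span ℚ (Set.range fun y : Y₀ => fun g : G => a (g • y)))
    have e2 := Submodule.finrank_sup_add_finrank_inf_eq
      (Submodule.span ℚ (Set.range fun y : Y₀ => fun g : G => (a + a') (g • y)))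
      (Submodule.span ℚ (Set.range fun y : Y₀ => fun g : G => a' (g • y)))
    have e3 := Submodule.finrank_sup_add_finrank_inf_eq
      (Submodule.span ℚ (Set.range fun y : Y₀ => fun g : G => a (g • y)))
      (Submodule.span ℚ (Set.range fun y : Y₀ => fun g : G => a' (g • y)))
    rw [hsup, h0, finrank_bot] at e1
    rw [hsup', h0', finrank_bot] at e2
    rw [hdisj, finrank_bot, hline] at e3
    have hSa := finrank_span_shadowCoeff_eq_of_irreducible hAst hirr ha ha0
    omega
  · have hle : Submodule.span ℚ (Set.range fun y : Y₀ => fun g : G => a (g • y)) ≤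
        Submodule.span ℚ (Set.range fun y : Y₀ => fun g : G => (a + a') (g • y)) := by
      rw [← hS]; exact inf_le_left
    have hle' : Submodule.span ℚ (Set.range fun y : Y₀ => fun g : G => a' (g • y)) ≤
        Submodule.span ℚ (Set.range fun y : Y₀ => fun g : G => (a + a') (g • y)) := by
      have h := span_shadowCoeff_le_add_sup (G := G) a' a
      rw [add_comm a' a] at h
      exact h.trans (sup_le le_rfl hle)
    exact sup_le hle hle'

end Summit.HodgeConjecture.CorCM.IrrOdd

end
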